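import Literature.Probability.LatticeModels.RandomClusterDomainToBox
import Literature.Probability.LatticeModels.RandomClusterDomainMarkovFree
import HarnessLib

/-!
# Wired domain versus pinned free box: a Holley comparison for decreasing events

Let two finite graphs be embedded in a common finite vertex type `U`: a "domain" graph `H` on `M`
(random-cluster measure `φ^B_{H,p,q}`, wired on `B`) and a "box" graph `P` on `V` (free measure
`φ⁰_{P,p,q}`). Call *pinned* the edges of `P` whose image is not the image of an edge of `H`
(`pinnedEdges`), and *transfer* a configuration `ω` of `H` to the configuration of `P` consisting
of the images of open edges of `H` that are edges of `P`, together with all pinned edges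
(`pinnedTransfer`, monotone in `ω`).

**Main result** (`rcMeasure_real_pinnedTransfer_le`). If every vertex of the domain which is an
endpoint of a pinned edge lies in the wired set `B`, then for `0 < p ≤ 1`, `q ≥ 1` and every
decreasing event `D` of the box,
`φ^B_{H,p,q}(transfer ∈ D) ≤ φ⁰_{P,p,q}(D)`.

*Proof.* On the lattice of edge sets of `U`, the law of the transferred configuration read on the
common edges is, up to normalisation, the *pinned free weight* `f(a) = w⁰_E(a ∪ E∖F)`
(`pinnedWeight`; `E`, `F` the images of the edge sets of `P`, `H`), and `φ^B_H` is
`g = fkWeight F (jB)`. Holley's condition `f(a) g(b) ≤ f(a ∩ b) g(a ∪ b)`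
(`pinnedWeight_mul_fkWeight_le`) reduces, after balancing the exponents of `p` and `1-p`, to
`k(a ∪ E∖F) + k^W(b) ≤ k((a ∩ b) ∪ E∖F) + k^W(a ∪ b)`. The pinned edges `K = E ∖ F` touch the
domain only inside `W`, so for configurations `c` of domain edges the count `k(c ∪ K)` differs
from `k(c ⊔ T)` by a constant, where `T` is the trace on the domain of `K`-connectivity
(`traceGraph`, `card_connectedComponent_sup_add_traceGraph` — proved by adding the edges of `c`
one at a time: the endpoints of a new edge are joined in `c ⊔ K` iff they are in `c ⊔ T`,
`reachable_sup_iff_reachable_sup_traceGraph`); and `T ≤ wired W`, so the mixed supermodularity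
of the number of clusters (`card_connectedComponent_sup_le_of_le`, Grimmett 2006, (3.12)) for
`graph(a ∩ b) ⊔ T ≤ graph(b) ⊔ wired W` and `S = graph(a)` gives the inequality. The four
functions theorem (Mathlib `four_functions_theorem_univ`, Holley 1974) then yields
`φ⁰_P(Dᶜ ∩ {K open}) ≤ φ^B_H(transfer ∈ Dᶜ) · φ⁰_P(K open)` (`sum_mul_pinnedWeight_mul_sum_le` and
the identification of the four sums, `sum_mul_fkWeight_map`, `sum_mul_pinnedWeight`), and the FKG
inequality `φ⁰_P(D ∩ {K open}) ≤ φ⁰_P(D) φ⁰_P(K open)` (`rcMeasure_real_inter_le_of_isLowerSet`)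
finishes.

This is the measure-theoretic half of the free-arc case of Smirnov's a priori interface estimate
(Smirnov 2010, Appendix A, proof of Lemma A.1: the dual cluster "treated similarly … since the
model is self-dual"): the wired domain measure of a discrete Dobrushin domain, far from the free
arc, dominates the free measure of a lattice box with the box edges off the domain pinned open;
combined with planar duality of the box (`RandomClusterBoxDuality`) it bounds the probability of
a dual arm. The companion comparison for increasing events (arm to a wired box) is
`RandomClusterDomainToBox`.

## References

* [cite: Grimmett2006, Thm. (3.21), eq. (3.12), Lemma (4.13)]
* [cite: Smirnov2010, Appendix A, proof of Lemma A.1]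
* R. Holley, *Remarks on the FKG inequalities*, Comm. Math. Phys. 36 (1974) — Mathlib
  `four_functions_theorem_univ` / `holley`.
-/

noncomputable section

namespace Literature.Probability.LatticeModels

open SimpleGraph Finset

/-! ### The trace of a graph's connectivity on a set of vertices -/

section Trace

variable {U : Type*} (D : Set U) (K : SimpleGraph U)

/-- The trace on `D` of the connectivity of `K`: two distinct vertices of `D` are adjacent iff
they are joined by a path of `K` (possibly leaving `D`). [folklore] -/
def traceGraph : SimpleGraph U := SimpleGraph.fromRel fun u v => u ∈ D ∧ v ∈ D ∧ K.Reachable u v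

variable {D K}

/-- Adjacency in the trace graph. [folklore] -/
theorem traceGraph_adj {u v : U} :
    (traceGraph D K).Adj u v ↔ u ≠ v ∧ u ∈ D ∧ v ∈ D ∧ K.Reachable u v := by
  simp only [traceGraph, fromRel_adj, ne_eq]
  constructor
  · rintro ⟨hne, h | h⟩
    · exact ⟨hne, h⟩
    · exact ⟨hne, h.2.1, h.1, h.2.2.symm⟩
  · rintro ⟨hne, h⟩
    exact ⟨hne, Or.inl h⟩

/-- A set of vertices closed under adjacency contains everything reachable from it. [folklore] -/
theorem mem_of_reachable_of_closed {H : SimpleGraph U} {C : Set U}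
    (hC : ∀ ⦃u v⦄, u ∈ C → H.Adj u v → v ∈ C) {x y : U} (hx : x ∈ C) (h : H.Reachable x y) :
    y ∈ C := by
  obtain ⟨p⟩ := h
  induction p with
  | nil => exact hx
  | cons hadj _ ih => exact ih (hC hx hadj)

/-- A vertex joined to a different vertex has a neighbour. [folklore] -/
theorem exists_adj_of_reachable_ne {H : SimpleGraph U} {u v : U} (h : H.Reachable u v) (hne : u ≠ v) :
    ∃ w, H.Adj u w := by
  obtain ⟨p⟩ := h
  cases p with
  | nil => exact absurd rfl hne
  | cons hadj _ => exact ⟨_, hadj⟩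

/-- **Reachability between vertices of `D` only sees the trace.** If every edge of `G` lies inside
`D`, two vertices of `D` are joined in `G ⊔ K` iff they are joined in `G ⊔ traceGraph D K`
(excursions of a path through `K` start and end at `K`-joined vertices of `D`). [folklore] -/
theorem reachable_sup_iff_reachable_sup_traceGraph {G : SimpleGraph U}
    (hG : ∀ ⦃u v⦄, G.Adj u v → u ∈ D ∧ v ∈ D) {x y : U} (hx : x ∈ D) (hy : y ∈ D) :
    (G ⊔ K).Reachable x y ↔ (G ⊔ traceGraph D K).Reachable x y := by
  constructor
  · intro h
    -- the set of vertices "accounted for" from `x`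
    set C : Set U := {v | (v ∈ D ∧ (G ⊔ traceGraph D K).Reachable x v) ∨
      (v ∉ D ∧ ∃ u ∈ D, (G ⊔ traceGraph D K).Reachable x u ∧ K.Reachable u v)} with hCdef
    have hxC : x ∈ C := Or.inl ⟨hx, Reachable.refl _⟩
    have hcl : ∀ ⦃u v⦄, u ∈ C → (G ⊔ K).Adj u v → v ∈ C := by
      intro u v hu huv
      rw [sup_adj] at huv
      rcases hu with ⟨huD, hxu⟩ | ⟨huD, w, hwD, hxw, hwu⟩
      · rcases huv with huv | huv
        · exact Or.inl ⟨(hG huv).2, hxu.trans (huv.reachable.mono le_sup_left)⟩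
        · by_cases hvD : v ∈ D
          · refine Or.inl ⟨hvD, hxu.trans (Adj.reachable ?_)⟩
            rw [sup_adj, traceGraph_adj]
            exact Or.inr ⟨huv.ne, huD, hvD, huv.reachable⟩
          · exact Or.inr ⟨hvD, u, huD, hxu, huv.reachable⟩
      · rcases huv with huv | huv
        · exact absurd (hG huv).1 huD
        · have hwv : K.Reachable w v := hwu.trans huv.reachable
          by_cases hvD : v ∈ D
          · by_cases hwv' : w = v
            · subst hwv'; exact Or.inl ⟨hvD, hxw⟩
            · refine Or.inl ⟨hvD, hxw.trans (Adj.reachable ?_)⟩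
              rw [sup_adj, traceGraph_adj]
              exact Or.inr ⟨hwv', hwD, hvD, hwv⟩
          · exact Or.inr ⟨hvD, w, hwD, hxw, hwv⟩
    rcases mem_of_reachable_of_closed hcl hxC h with ⟨-, h'⟩ | ⟨hyD, -⟩
    · exact h'
    · exact absurd hy hyD
  · rintro ⟨p⟩
    clear hx
    induction p with
    | nil => exact Reachable.refl _
    | @cons a b c hadj p ih =>
      refine Reachable.trans ?_ (ih hy)
      rw [sup_adj] at hadj
      rcases hadj with hadj | hadj
      · exact hadj.reachable.mono le_sup_left
      · exact ((traceGraph_adj.1 hadj).2.2.2).mono le_sup_right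

/-- The open graph of a union of finite edge sets. [folklore] -/
theorem openGraph_coe_union [DecidableEq U] (s t : Finset (Sym2 U)) :
    Percolation.openGraph (↑(s ∪ t) : Set (Sym2 U)) =
      Percolation.openGraph (↑s : Set (Sym2 U)) ⊔ Percolation.openGraph (↑t : Set (Sym2 U)) := by
  rw [Finset.coe_union]
  exact fromEdgeSet_union _ _

/-- The open graph of `insert e ω` is the open graph of `ω` plus the edge `e` (a local copy of
`FKInterfacePairing.openGraph_coe_insert`, to keep the imports light). [folklore] -/
private theorem openGraph_insert_eq_sup_edge [DecidableEq U] (x y : U) (s : Finset (Sym2 U)) :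
    Percolation.openGraph (↑(insert s(x, y) s) : Set (Sym2 U)) =
      Percolation.openGraph (↑s : Set (Sym2 U)) ⊔ edge x y := by
  rw [Finset.coe_insert, Set.insert_eq, Percolation.openGraph, fromEdgeSet_union, sup_comm]
  rfl

variable [Finite U]

/-- Adding an edge changes the number of components of two graphs in the same way as soon as its
endpoints are joined in both or in neither. [folklore] -/
theorem card_connectedComponent_sup_edge_add_eq {K L : SimpleGraph U} {u v : U}
    (h : K.Reachable u v ↔ L.Reachable u v) :
    Nat.card (K ⊔ edge u v).ConnectedComponent + Nat.card L.ConnectedComponent =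
      Nat.card K.ConnectedComponent + Nat.card (L ⊔ edge u v).ConnectedComponent := by
  by_cases huv : K.Reachable u v
  · rw [card_connectedComponent_sup_edge_of_reachable K huv,
      card_connectedComponent_sup_edge_of_reachable L (h.1 huv), add_comm]
  · have hL : ¬ L.Reachable u v := fun h' => huv (h.2 h')
    have h1 := card_connectedComponent_sup_edge_lt K huv
    have h2 := card_connectedComponent_le_sup_edge_add_one K u v
    have h3 := card_connectedComponent_sup_edge_lt L hL
    have h4 := card_connectedComponent_le_sup_edge_add_one L u v
    omega

/-- **Constant shift.** For a graph `G = openGraph a` with all edges inside `D`, replacing the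
environment `K` by its trace on `D` changes the number of components of `G ⊔ ·` by an amount
independent of `G`: `k(G ⊔ K) + k(tr K) = k(G ⊔ tr K) + k(K)`. [folklore] -/
theorem card_connectedComponent_sup_add_traceGraph [DecidableEq U] (a : Finset (Sym2 U))
    (ha : ∀ e ∈ a, ∀ u ∈ e, u ∈ D) :
    Nat.card (Percolation.openGraph (↑a : Set (Sym2 U)) ⊔ K).ConnectedComponent +
        Nat.card (traceGraph D K).ConnectedComponent =
      Nat.card (Percolation.openGraph (↑a : Set (Sym2 U)) ⊔ traceGraph D K).ConnectedComponent +
        Nat.card K.ConnectedComponent := by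
  induction a using Finset.induction_on with
  | empty =>
    have h0 : Percolation.openGraph (↑(∅ : Finset (Sym2 U)) : Set (Sym2 U)) = ⊥ := by
      rw [Finset.coe_empty, Percolation.openGraph, fromEdgeSet_empty]
    rw [h0, bot_sup_eq, bot_sup_eq, add_comm]
  | @insert e a hea ih =>
    have ha' : ∀ e' ∈ a, ∀ u ∈ e', u ∈ D := fun e' he' => ha e' (Finset.mem_insert_of_mem he')
    have ih' := ih ha'
    induction e using Sym2.ind with
    | h x y =>
      have hx : x ∈ D := ha _ (Finset.mem_insert_self _ _) x (Sym2.mem_mk_left _ _)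
      have hy : y ∈ D := ha _ (Finset.mem_insert_self _ _) y (Sym2.mem_mk_right _ _)
      have hG : ∀ ⦃u v⦄, (Percolation.openGraph (↑a : Set (Sym2 U))).Adj u v → u ∈ D ∧ v ∈ D := by
        intro u v huv
        rw [Percolation.openGraph_adj] at huv
        exact ⟨ha' _ huv.1 u (Sym2.mem_mk_left _ _), ha' _ huv.1 v (Sym2.mem_mk_right _ _)⟩
      have hiff := reachable_sup_iff_reachable_sup_traceGraph (K := K) hG hx hy
      have hstep := card_connectedComponent_sup_edge_add_eq hiff
      rw [openGraph_insert_eq_sup_edge, sup_right_comm _ _ K, sup_right_comm _ _ (traceGraph D K)]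
      omega

end Trace

/-! ### Random-cluster weights on a common vertex type; the pinned free weights -/

section Weights

variable {U : Type*} [Fintype U] [DecidableEq U]

/-- The random-cluster weight, on the finite vertex type `U`, of the edge set `ξ` relative to the
edge set `E` and the wired set `W`: `p^{|ξ|} (1-p)^{|E ∖ ξ|} q^{k^W(ξ)}`, zero unless `ξ ⊆ E`.
(`domWeight` of `RandomClusterDomainToBox` is the case `E = domEdges`, `W = jDom '' B`.)
[cite: Grimmett2006, §1.2, eq. (1.2); §4.2] -/
def fkWeight (E : Finset (Sym2 U)) (W : Set U) (p q : ℝ) (ξ : Finset (Sym2 U)) : ℝ :=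
  if ξ ⊆ E then
    p ^ #ξ * (1 - p) ^ #(E \ ξ) * q ^ Nat.card (wiredOpenGraph (↑ξ : Set (Sym2 U)) W).ConnectedComponent
  else 0

/-- The **pinned free weights**: the free random-cluster weight on the edge set `E` of the
configuration `a ∪ (E ∖ F)` — the edges of `E` off `F` pinned open — as a function of the
remaining coordinates `a ⊆ E ∩ F`; zero off the subsets of `E ∩ F`. Up to normalisation this
is the law of `ω ∩ F` under `φ⁰_{E,p,q}( · | every edge of E ∖ F is open)`.
[cite: Grimmett2006, §3.1 and Thm. (3.21)] -/
def pinnedWeight (E F : Finset (Sym2 U)) (p q : ℝ) (a : Finset (Sym2 U)) : ℝ :=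
  if a ⊆ E ∩ F then fkWeight E ∅ p q (a ∪ E \ F) else 0

variable {E F : Finset (Sym2 U)} {W D : Set U} {p q : ℝ}

omit [Fintype U] in
/-- Random-cluster weights are nonnegative. [cite: Grimmett2006, §1.2] -/
theorem fkWeight_nonneg (hp : p ∈ Set.Icc (0 : ℝ) 1) (hq : 0 ≤ q) (ξ : Finset (Sym2 U)) :
    0 ≤ fkWeight E W p q ξ := by
  unfold fkWeight
  have h0 : 0 ≤ p := hp.1
  have h1 : 0 ≤ 1 - p := sub_nonneg.2 hp.2
  split_ifs
  · exact mul_nonneg (mul_nonneg (pow_nonneg h0 _) (pow_nonneg h1 _)) (pow_nonneg hq _)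
  · exact le_rfl

omit [Fintype U] in
/-- Pinned free weights are nonnegative. [cite: Grimmett2006, §1.2] -/
theorem pinnedWeight_nonneg (hp : p ∈ Set.Icc (0 : ℝ) 1) (hq : 0 ≤ q) (a : Finset (Sym2 U)) :
    0 ≤ pinnedWeight E F p q a := by
  unfold pinnedWeight
  split_ifs
  · exact fkWeight_nonneg hp hq _
  · exact le_rfl

omit [Fintype U] in
/-- The trace on `D` of the connectivity of the pinned edges lies inside the wiring of `W` as
soon as every endpoint in `D` of a pinned edge is wired. [folklore] -/
theorem traceGraph_le_wired (hoff : ∀ e ∈ E, e ∉ F → ∀ u ∈ e, u ∈ D → u ∈ W) :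
    traceGraph D (Percolation.openGraph (↑(E \ F) : Set (Sym2 U))) ≤ wired W := by
  intro u v huv
  obtain ⟨hne, hu, hv, hr⟩ := traceGraph_adj.1 huv
  have key : ∀ {a b : U}, a ∈ D →
      (Percolation.openGraph (↑(E \ F) : Set (Sym2 U))).Reachable a b → a ≠ b → a ∈ W := by
    intro a b ha hab hne'
    obtain ⟨w, haw⟩ := exists_adj_of_reachable_ne hab hne'
    rw [Percolation.openGraph_adj, Finset.mem_coe, Finset.mem_sdiff] at haw
    exact hoff _ haw.1.1 haw.1.2 a (Sym2.mem_mk_left _ _) ha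
  rw [wired_adj]
  exact ⟨hne, key hu hr hne, key hv hr.symm hne.symm⟩

/-- **Holley's condition for the pair (pinned free weights, wired domain weights).** For
`0 ≤ p ≤ 1`, `q ≥ 1`, edge sets `E` ("box") and `F` ("domain", all of whose edges lie inside
`D`) and a wired set `W` containing every endpoint in `D` of an edge of `E ∖ F`:
`f(a) g(b) ≤ f(a ∩ b) g(a ∪ b)` with `f = pinnedWeight E F`, `g = fkWeight F W`. The exponents
of `p` and `1 - p` balance; for the cluster counts, the constant shift
`card_connectedComponent_sup_add_traceGraph` replaces the pinned edges by their trace `T` on `D`,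
`T ≤ wired W`, and the mixed supermodularity `card_connectedComponent_sup_le_of_le` applies to
`graph(a ∩ b) ⊔ T ≤ graph(b) ⊔ wired W` and `S = graph(a)`.
[cite: Grimmett2006, Thm. (3.21) and eq. (3.12)] -/
theorem pinnedWeight_mul_fkWeight_le (hp : p ∈ Set.Icc (0 : ℝ) 1) (hq : 1 ≤ q)
    (hF : ∀ e ∈ F, ∀ u ∈ e, u ∈ D) (hoff : ∀ e ∈ E, e ∉ F → ∀ u ∈ e, u ∈ D → u ∈ W)
    (a b : Finset (Sym2 U)) :
    pinnedWeight E F p q a * fkWeight F W p q b ≤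
      pinnedWeight E F p q (a ∩ b) * fkWeight F W p q (a ∪ b) := by
  have hq0 : 0 ≤ q := zero_le_one.trans hq
  have h0 : 0 ≤ p := hp.1
  have h1p : 0 ≤ 1 - p := sub_nonneg.2 hp.2
  by_cases ha : a ⊆ E ∩ F
  swap
  · rw [pinnedWeight, if_neg ha, zero_mul]
    exact mul_nonneg (pinnedWeight_nonneg hp hq0 _) (fkWeight_nonneg hp hq0 _)
  by_cases hb : b ⊆ F
  swap
  · rw [fkWeight, if_neg hb, mul_zero]
    exact mul_nonneg (pinnedWeight_nonneg hp hq0 _) (fkWeight_nonneg hp hq0 _)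
  have haE : a ⊆ E := ha.trans Finset.inter_subset_left
  have haF : a ⊆ F := ha.trans Finset.inter_subset_right
  have hab : a ∩ b ⊆ E ∩ F := Finset.inter_subset_left.trans ha
  have hab' : a ∪ b ⊆ F := Finset.union_subset haF hb
  have h1 : a ∪ E \ F ⊆ E := Finset.union_subset haE Finset.sdiff_subset
  have h2 : a ∩ b ∪ E \ F ⊆ E := Finset.union_subset (Finset.inter_subset_left.trans haE) Finset.sdiff_subset
  rw [pinnedWeight, if_pos ha, pinnedWeight, if_pos hab, fkWeight, if_pos h1, fkWeight, if_pos hb,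
    fkWeight, if_pos h2, fkWeight, if_pos hab']
  -- cardinalities
  have hdisj : ∀ c : Finset (Sym2 U), c ⊆ F → Disjoint c (E \ F) := fun c hc =>
    Finset.disjoint_left.2 fun e he he' => (Finset.mem_sdiff.1 he').2 (hc he)
  have c1 : #(a ∪ E \ F) = #a + #(E \ F) := Finset.card_union_of_disjoint (hdisj a haF)
  have c2 : #(a ∩ b ∪ E \ F) = #(a ∩ b) + #(E \ F) :=
    Finset.card_union_of_disjoint (hdisj _ (Finset.inter_subset_left.trans haF))
  have c3 := Finset.card_sdiff_of_subset h1
  have c4 := Finset.card_sdiff_of_subset h2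
  have c5 := Finset.card_sdiff_of_subset hb
  have c6 := Finset.card_sdiff_of_subset hab'
  have c7 := Finset.card_union_add_card_inter a b
  have l1 := Finset.card_le_card h1
  have l2 := Finset.card_le_card h2
  have l5 := Finset.card_le_card hb
  have l6 := Finset.card_le_card hab'
  have ep : #(a ∪ E \ F) + #b = #(a ∩ b ∪ E \ F) + #(a ∪ b) := by omega
  have e1p : #(E \ (a ∪ E \ F)) + #(F \ b) = #(E \ (a ∩ b ∪ E \ F)) + #(F \ (a ∪ b)) := by omega
  -- cluster counts
  set K := Percolation.openGraph (↑(E \ F) : Set (Sym2 U)) with hK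
  have hfree : ∀ c : Finset (Sym2 U), wiredOpenGraph (↑(c ∪ E \ F) : Set (Sym2 U)) ∅ =
      Percolation.openGraph (↑c : Set (Sym2 U)) ⊔ K := by
    intro c
    rw [wiredOpenGraph, wired_empty, sup_bot_eq, openGraph_coe_union]
  have hins : ∀ c : Finset (Sym2 U), c ⊆ F → ∀ e ∈ c, ∀ u ∈ e, u ∈ D := fun c hc e he => hF e (hc he)
  have csa := card_connectedComponent_sup_add_traceGraph (K := K) a (hins a haF)
  have csab := card_connectedComponent_sup_add_traceGraph (K := K) (a ∩ b)
    (hins _ (Finset.inter_subset_left.trans haF))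
  have hle : Percolation.openGraph (↑(a ∩ b) : Set (Sym2 U)) ⊔ traceGraph D K ≤
      Percolation.openGraph (↑b : Set (Sym2 U)) ⊔ wired W :=
    sup_le_sup (Percolation.openGraph_mono (Finset.coe_subset.2 Finset.inter_subset_right))
      (traceGraph_le_wired hoff)
  have hmix := card_connectedComponent_sup_le_of_le (Percolation.openGraph (↑a : Set (Sym2 U))) hle
  have e3 : Percolation.openGraph (↑(a ∩ b) : Set (Sym2 U)) ⊔ traceGraph D K ⊔
        Percolation.openGraph (↑a : Set (Sym2 U)) =
      Percolation.openGraph (↑a : Set (Sym2 U)) ⊔ traceGraph D K := by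
    rw [sup_right_comm, sup_eq_right.2
      (Percolation.openGraph_mono (Finset.coe_subset.2 Finset.inter_subset_left) :
        Percolation.openGraph (↑(a ∩ b) : Set (Sym2 U)) ≤ Percolation.openGraph (↑a : Set (Sym2 U)))]
  have e4 : Percolation.openGraph (↑b : Set (Sym2 U)) ⊔ wired W ⊔ Percolation.openGraph (↑a : Set (Sym2 U)) =
      wiredOpenGraph (↑(a ∪ b) : Set (Sym2 U)) W := by
    rw [wiredOpenGraph, sup_right_comm, openGraph_coe_union, sup_comm (Percolation.openGraph (↑a : Set (Sym2 U)))]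
  rw [e3, e4] at hmix
  have kq : Nat.card (wiredOpenGraph (↑(a ∪ E \ F) : Set (Sym2 U)) ∅).ConnectedComponent +
      Nat.card (wiredOpenGraph (↑b : Set (Sym2 U)) W).ConnectedComponent ≤
      Nat.card (wiredOpenGraph (↑(a ∩ b ∪ E \ F) : Set (Sym2 U)) ∅).ConnectedComponent +
      Nat.card (wiredOpenGraph (↑(a ∪ b) : Set (Sym2 U)) W).ConnectedComponent := by
    rw [hfree, hfree]
    have e5 : wiredOpenGraph (↑b : Set (Sym2 U)) W = Percolation.openGraph (↑b : Set (Sym2 U)) ⊔ wired W := rfl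
    rw [e5]
    omega
  -- assemble
  have key : ∀ (x1 y1 k1 x2 y2 k2 x1' y1' k1' x2' y2' k2' : ℕ), x1 + x2 = x1' + x2' →
      y1 + y2 = y1' + y2' → k1 + k2 ≤ k1' + k2' →
      p ^ x1 * (1 - p) ^ y1 * q ^ k1 * (p ^ x2 * (1 - p) ^ y2 * q ^ k2) ≤
        p ^ x1' * (1 - p) ^ y1' * q ^ k1' * (p ^ x2' * (1 - p) ^ y2' * q ^ k2') := by
    intro x1 y1 k1 x2 y2 k2 x1' y1' k1' x2' y2' k2' hx hy hk
    calc p ^ x1 * (1 - p) ^ y1 * q ^ k1 * (p ^ x2 * (1 - p) ^ y2 * q ^ k2)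
        = p ^ (x1 + x2) * (1 - p) ^ (y1 + y2) * q ^ (k1 + k2) := by rw [pow_add, pow_add, pow_add]; ring
      _ ≤ p ^ (x1 + x2) * (1 - p) ^ (y1 + y2) * q ^ (k1' + k2') :=
          mul_le_mul_of_nonneg_left (pow_le_pow_right₀ hq hk)
            (mul_nonneg (pow_nonneg h0 _) (pow_nonneg h1p _))
      _ = p ^ (x1' + x2') * (1 - p) ^ (y1' + y2') * q ^ (k1' + k2') := by rw [hx, hy]
      _ = _ := by rw [pow_add, pow_add, pow_add]; ring
  exact key _ _ _ _ _ _ _ _ _ _ _ _ ep e1p kq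

end Weights

/-! ### Holley's inequality for the pair, and the two sums as random-cluster measures -/

section Sums

variable {U : Type*} [Fintype U] [DecidableEq U] {E F : Finset (Sym2 U)} {W D : Set U} {p q : ℝ}

/-- **The pinned free measure is dominated by the wired domain measure** (unnormalised form of
Holley's inequality, via the four functions theorem): for every nonnegative monotone `μ`,
`(Σ μ f)(Σ g) ≤ (Σ μ g)(Σ f)` with `f = pinnedWeight E F`, `g = fkWeight F W`.
[cite: Grimmett2006, Thm. (3.21); Holley 1974] -/
theorem sum_mul_pinnedWeight_mul_sum_le (hp : p ∈ Set.Icc (0 : ℝ) 1) (hq : 1 ≤ q)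
    (hF : ∀ e ∈ F, ∀ u ∈ e, u ∈ D) (hoff : ∀ e ∈ E, e ∉ F → ∀ u ∈ e, u ∈ D → u ∈ W)
    (μ : Finset (Sym2 U) → ℝ) (hμ0 : 0 ≤ μ) (hμ : Monotone μ) :
    (∑ a, μ a * pinnedWeight E F p q a) * ∑ b, fkWeight F W p q b ≤
      (∑ b, μ b * fkWeight F W p q b) * ∑ a, pinnedWeight E F p q a := by
  have hq0 : 0 ≤ q := zero_le_one.trans hq
  have hg0 : 0 ≤ fkWeight F W p q := fun ξ => fkWeight_nonneg hp hq0 ξ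
  have hf0 : 0 ≤ pinnedWeight E F p q := fun a => pinnedWeight_nonneg hp hq0 a
  have h := four_functions_theorem_univ (fkWeight F W p q) (μ * pinnedWeight E F p q)
    (pinnedWeight E F p q) (μ * fkWeight F W p q) hg0 (mul_nonneg hμ0 hf0) hf0 (mul_nonneg hμ0 hg0)
    (fun a b => by
      simp only [Pi.mul_apply]
      have c := pinnedWeight_mul_fkWeight_le hp hq hF hoff b a
      rw [Finset.inter_comm, Finset.union_comm] at c
      have hμle : μ b ≤ μ (a ∪ b) := hμ Finset.subset_union_right
      calc fkWeight F W p q a * (μ b * pinnedWeight E F p q b)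
          = μ b * (pinnedWeight E F p q b * fkWeight F W p q a) := by ring
        _ ≤ μ (a ∪ b) * (pinnedWeight E F p q (a ∩ b) * fkWeight F W p q (a ∪ b)) :=
            mul_le_mul hμle c (mul_nonneg (hf0 _) (hg0 _)) (hμ0 _)
        _ = pinnedWeight E F p q (a ⊓ b) * (μ (a ⊔ b) * fkWeight F W p q (a ⊔ b)) := by
            rw [Finset.inf_eq_inter, Finset.sup_eq_union]; ring)
  simp only [Pi.mul_apply] at h
  calc (∑ a, μ a * pinnedWeight E F p q a) * ∑ b, fkWeight F W p q b
      = (∑ b, fkWeight F W p q b) * ∑ a, μ a * pinnedWeight E F p q a := mul_comm _ _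
    _ ≤ (∑ a, pinnedWeight E F p q a) * ∑ b, μ b * fkWeight F W p q b := h
    _ = _ := mul_comm _ _

/-- The sets of edges inside an embedded edge set are the images of its subsets. [folklore] -/
theorem filter_subset_map_sym2Map_eq {V : Type*} (j : V ↪ U) (S : Finset (Sym2 V)) :
    (Finset.univ.filter fun a : Finset (Sym2 U) => a ⊆ S.map j.sym2Map) =
      S.powerset.map ⟨fun ω => ω.map j.sym2Map, Finset.map_injective _⟩ := by
  ext a
  simp only [Finset.mem_filter, Finset.mem_univ, true_and, Finset.mem_map, Finset.mem_powerset,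
    Function.Embedding.coeFn_mk]
  constructor
  · intro ha
    obtain ⟨u, hu, rfl⟩ := Finset.subset_map_iff.1 ha
    exact ⟨u, hu, rfl⟩
  · rintro ⟨ω, hω, rfl⟩
    exact Finset.map_subset_map.2 hω

/-- **An embedded random-cluster measure.** Summing a function against the weights `fkWeight` of
the image of a finite graph `H` under an injection `j` of vertex types (wired on the image of `B`)
is `q^{#vertices off the range}` times summing it against the random-cluster weights of `H`
(generalises `sum_mul_domWeight`). [cite: Grimmett2006, §1.2, eq. (1.2)] -/
theorem sum_mul_fkWeight_map {V : Type*} [Fintype V] [DecidableEq V] (j : V ↪ U) (H : SimpleGraph V)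
    [DecidableRel H.Adj] (B : Set V) (p q : ℝ) (G : Finset (Sym2 U) → ℝ) :
    ∑ a, G a * fkWeight (H.edgeFinset.map j.sym2Map) (j '' B) p q a =
      q ^ Nat.card {u : U // u ∉ Set.range j} *
        ∑ ω ∈ H.edgeFinset.powerset, G (ω.map j.sym2Map) * rcWeight H p q B ω := by
  have step1 : ∑ a, G a * fkWeight (H.edgeFinset.map j.sym2Map) (j '' B) p q a =
      ∑ a ∈ Finset.univ.filter (fun a : Finset (Sym2 U) => a ⊆ H.edgeFinset.map j.sym2Map),
        G a * fkWeight (H.edgeFinset.map j.sym2Map) (j '' B) p q a := by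
    rw [Finset.sum_filter]
    refine Finset.sum_congr rfl fun a _ => ?_
    by_cases ha : a ⊆ H.edgeFinset.map j.sym2Map
    · rw [if_pos ha]
    · rw [if_neg ha, fkWeight, if_neg ha, mul_zero]
  rw [step1, filter_subset_map_sym2Map_eq, Finset.sum_map, Finset.mul_sum]
  refine Finset.sum_congr rfl fun ω hω => ?_
  rw [Finset.mem_powerset] at hω
  simp only [Function.Embedding.coeFn_mk]
  have hsub : ω.map j.sym2Map ⊆ H.edgeFinset.map j.sym2Map := Finset.map_subset_map.2 hω
  rw [fkWeight, if_pos hsub, rcWeight]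
  have e1 : #(ω.map j.sym2Map) = #ω := Finset.card_map _
  have e2 : #(H.edgeFinset.map j.sym2Map \ ω.map j.sym2Map) = #(H.edgeFinset \ ω) := by
    rw [Finset.card_sdiff_of_subset hsub, Finset.card_sdiff_of_subset hω, Finset.card_map,
      Finset.card_map]
  have e3 : Nat.card (wiredOpenGraph (↑(ω.map j.sym2Map) : Set (Sym2 U)) (j '' B)).ConnectedComponent =
      clusterCount (↑ω : Percolation.BondConfig V) B + Nat.card {u : U // u ∉ Set.range j} := by
    have hcoe : (↑(ω.map j.sym2Map) : Set (Sym2 U)) = Sym2.map j '' (↑ω : Set (Sym2 V)) := by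
      rw [Finset.coe_map]; rfl
    rw [hcoe, card_connectedComponent_image_eq_add]
    rfl
  rw [e1, e2, e3, pow_add]
  ring

/-- **The pinned sum is a conditioned free sum.** Summing `G` against the pinned free weights is
summing `ξ ↦ G(ξ ∩ F)` against the free weights of `E` over the configurations `ξ` in which every
pinned edge is open. [cite: Grimmett2006, §3.1] -/
theorem sum_mul_pinnedWeight (E F : Finset (Sym2 U)) (p q : ℝ) (G : Finset (Sym2 U) → ℝ) :
    ∑ a, G a * pinnedWeight E F p q a =
      ∑ ξ ∈ E.powerset.filter (fun ξ => E \ F ⊆ ξ), G (ξ ∩ F) * fkWeight E ∅ p q ξ := by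
  have step1 : ∑ a, G a * pinnedWeight E F p q a =
      ∑ a ∈ Finset.univ.filter (fun a : Finset (Sym2 U) => a ⊆ E ∩ F),
        G a * fkWeight E ∅ p q (a ∪ E \ F) := by
    rw [Finset.sum_filter]
    refine Finset.sum_congr rfl fun a _ => ?_
    by_cases ha : a ⊆ E ∩ F
    · rw [if_pos ha, pinnedWeight, if_pos ha]
    · rw [if_neg ha, pinnedWeight, if_neg ha, mul_zero]
  rw [step1]
  have linv : ∀ a : Finset (Sym2 U), a ⊆ E ∩ F → (a ∪ E \ F) ∩ F = a := by
    intro a ha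
    ext e
    rw [Finset.mem_inter, Finset.mem_union, Finset.mem_sdiff]
    constructor
    · rintro ⟨h | h, he⟩
      · exact h
      · exact absurd he h.2
    · intro h
      exact ⟨Or.inl h, (Finset.mem_inter.1 (ha h)).2⟩
  have rinv : ∀ ξ : Finset (Sym2 U), ξ ⊆ E → E \ F ⊆ ξ → ξ ∩ F ∪ E \ F = ξ := by
    intro ξ hξ hoff
    ext e
    rw [Finset.mem_union, Finset.mem_inter, Finset.mem_sdiff]
    constructor
    · rintro (h | h)
      · exact h.1
      · exact hoff (Finset.mem_sdiff.2 h)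
    · intro h
      by_cases heF : e ∈ F
      · exact Or.inl ⟨h, heF⟩
      · exact Or.inr ⟨hξ h, heF⟩
  refine Finset.sum_nbij' (fun a => a ∪ E \ F) (fun ξ => ξ ∩ F) ?_ ?_ ?_ ?_ ?_
  · intro a ha
    rw [Finset.mem_filter] at ha
    rw [Finset.mem_filter, Finset.mem_powerset]
    exact ⟨Finset.union_subset (ha.2.trans Finset.inter_subset_left) Finset.sdiff_subset,
      Finset.subset_union_right⟩
  · intro ξ hξ
    rw [Finset.mem_filter, Finset.mem_powerset] at hξ
    rw [Finset.mem_filter]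
    exact ⟨Finset.mem_univ _, Finset.inter_subset_inter hξ.1 subset_rfl⟩
  · intro a ha
    rw [Finset.mem_filter] at ha
    exact linv a ha.2
  · intro ξ hξ
    rw [Finset.mem_filter, Finset.mem_powerset] at hξ
    exact rinv ξ hξ.1 hξ.2
  · intro a ha
    rw [Finset.mem_filter] at ha
    rw [linv a ha.2]

end Sums

/-! ### Two finite graphs embedded in a common vertex type: the comparison of measures -/

section Embedded

variable {U : Type*} [Fintype U] [DecidableEq U]
  {M : Type*} [Fintype M] [DecidableEq M] (jM : M ↪ U) (H : SimpleGraph M) [DecidableRel H.Adj]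
  {V : Type*} [Fintype V] [DecidableEq V] (jP : V ↪ U) (P : SimpleGraph V) [DecidableRel P.Adj]

/-- The **pinned edges**: the edges of the "box" graph `P` whose image in the common vertex type
is not the image of an edge of the "domain" graph `H`. [cite: Grimmett2006, §3.1] -/
def pinnedEdges : Finset (Sym2 V) :=
  P.edgeFinset.filter fun e => jP.sym2Map e ∉ H.edgeFinset.map jM.sym2Map

/-- The **transfer of a domain configuration to the box**: the configuration of `P` consisting of
the edges of `P` that are images of open edges of `H`, together with all pinned edges.
Monotone in `ω`. [cite: Grimmett2006, §3.1 and Thm. (3.21)] -/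
def pinnedTransfer (ω : Percolation.BondConfig M) : Percolation.BondConfig V :=
  Sym2.map jP ⁻¹'
    ((Sym2.map jM '' ω ∩ ↑(P.edgeFinset.map jP.sym2Map ∩ H.edgeFinset.map jM.sym2Map)) ∪
      ↑(P.edgeFinset.map jP.sym2Map \ H.edgeFinset.map jM.sym2Map))

variable {jM H jP P}

omit [Fintype U] [DecidableEq M] [DecidableEq V] in
/-- The images of the pinned edges are the box edges off the domain edges. [folklore] -/
theorem map_pinnedEdges :
    (pinnedEdges jM H jP P).map jP.sym2Map =
      P.edgeFinset.map jP.sym2Map \ H.edgeFinset.map jM.sym2Map := by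
  ext e
  rw [Finset.mem_map, Finset.mem_sdiff, Finset.mem_map]
  constructor
  · rintro ⟨e', he', rfl⟩
    rw [pinnedEdges, Finset.mem_filter] at he'
    exact ⟨⟨e', he'.1, rfl⟩, he'.2⟩
  · rintro ⟨⟨e', he', rfl⟩, hn⟩
    exact ⟨e', Finset.mem_filter.2 ⟨he', hn⟩, rfl⟩

omit [Fintype U] [DecidableEq U] [Fintype V] [DecidableEq V] in
/-- Pulling back an image configuration of the box recovers it. [folklore] -/
theorem preimage_coe_map_sym2Map (ξ : Finset (Sym2 V)) :
    Sym2.map jP ⁻¹' (↑(ξ.map jP.sym2Map) : Set (Sym2 U)) = ↑ξ := by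
  ext e
  rw [Set.mem_preimage, Finset.mem_coe, Finset.mem_coe, Finset.mem_map]
  constructor
  · rintro ⟨e', he', h⟩
    rwa [← Sym2.map.injective jP.injective h]
  · intro he
    exact ⟨e, he, rfl⟩

/-- **Comparison between a wired domain and a pinned free box, for decreasing events.** Let the
finite graphs `H` ("domain", wired on `B`) and `P` ("box", free) be embedded in a common vertex
type, and suppose every domain endpoint of a pinned edge (a box edge that is not a domain edge)
lies in the wired set `B`. Then for `0 < p ≤ 1`, `q ≥ 1` and every decreasing event `D` of the
box, `φ^B_{H,p,q}(transfer⁻¹ D) ≤ φ⁰_{P,p,q}(D)`: by Holley's inequality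
(`sum_mul_pinnedWeight_mul_sum_le`) the law of the transferred configuration — the free measure
of `P` conditioned on the pinned edges being open, read on the common edges — is dominated by
`φ^B_H`, and by the FKG inequality conditioning a decreasing event on edges being open only
lowers its probability. (Smirnov 2010, App. A, proof of Lemma A.1, the dual/free-arc case
"treated similarly … since the model is self-dual"; Grimmett 2006, Thm. (3.21), Lemma (4.13).)
[cite: Smirnov2010, Appendix A, proof of Lemma A.1; Grimmett2006, Thm. (3.21)] -/
theorem rcMeasure_real_pinnedTransfer_le {B : Set M} {p q : ℝ} (hp : p ∈ Set.Ioc (0 : ℝ) 1)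
    (hq : 1 ≤ q)
    (hpin : ∀ e ∈ pinnedEdges jM H jP P, ∀ x : M, jM x ∈ jP.sym2Map e → x ∈ B)
    {DV : Set (Percolation.BondConfig V)} (hDV : IsLowerSet DV) :
    (rcMeasure H p q B).real {ω | pinnedTransfer jM H jP P ω ∈ DV} ≤ (rcMeasure P p q ∅).real DV := by
  classical
  have hp' : p ∈ Set.Icc (0 : ℝ) 1 := ⟨hp.1.le, hp.2⟩
  have hq0 : 0 < q := one_pos.trans_le hq
  -- the data of the abstract comparison
  set E : Finset (Sym2 U) := P.edgeFinset.map jP.sym2Map with hE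
  set F : Finset (Sym2 U) := H.edgeFinset.map jM.sym2Map with hF
  set W : Set U := jM '' B with hW
  set Dm : Set U := Set.range jM with hDm
  have hFD : ∀ e ∈ F, ∀ u ∈ e, u ∈ Dm := by
    intro e he u hu
    obtain ⟨e', -, rfl⟩ := Finset.mem_map.1 he
    rw [Function.Embedding.sym2Map_apply, Sym2.mem_map] at hu
    obtain ⟨x, -, rfl⟩ := hu
    exact ⟨x, rfl⟩
  have hoff : ∀ e ∈ E, e ∉ F → ∀ u ∈ e, u ∈ Dm → u ∈ W := by
    intro e he heF u hu huD
    obtain ⟨e', he', rfl⟩ := Finset.mem_map.1 he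
    obtain ⟨x, rfl⟩ := huD
    exact ⟨x, hpin e' (Finset.mem_filter.2 ⟨he', heF⟩) x hu, rfl⟩
  -- the increasing event and the monotone functional
  set AV : Set (Percolation.BondConfig V) := DVᶜ with hAV
  have hAVu : IsUpperSet AV := hDV.compl
  set μ : Finset (Sym2 U) → ℝ := fun c =>
    if Sym2.map jP ⁻¹' (↑(c ∩ (E ∩ F) ∪ E \ F) : Set (Sym2 U)) ∈ AV then 1 else 0 with hμ
  have hμ0 : 0 ≤ μ := fun c => by simp only [hμ, Pi.zero_apply]; split_ifs <;> norm_num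
  have hμm : Monotone μ := by
    intro c c' hcc'
    simp only [hμ]
    by_cases hc : Sym2.map jP ⁻¹' (↑(c ∩ (E ∩ F) ∪ E \ F) : Set (Sym2 U)) ∈ AV
    · have hc' : Sym2.map jP ⁻¹' (↑(c' ∩ (E ∩ F) ∪ E \ F) : Set (Sym2 U)) ∈ AV := by
        refine hAVu (Set.preimage_mono (Finset.coe_subset.2 ?_)) hc
        exact Finset.union_subset_union (Finset.inter_subset_inter hcc' subset_rfl) subset_rfl
      rw [if_pos hc, if_pos hc']
    · rw [if_neg hc]; split_ifs <;> norm_num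
  have key := sum_mul_pinnedWeight_mul_sum_le hp' hq hFD hoff μ hμ0 hμm
  -- the four sums
  set ZH := rcPartitionFunction H p q B with hZH
  set ZP := rcPartitionFunction P p q ∅ with hZP
  have hZH0 : 0 < ZH := rcPartitionFunction_pos H hp' hq0 B
  have hZP0 : 0 < ZP := rcPartitionFunction_pos P hp' hq0 ∅
  set cM := Nat.card {u : U // u ∉ Set.range jM} with hcM
  set cP := Nat.card {u : U // u ∉ Set.range jP} with hcP
  set O : Set (Percolation.BondConfig V) := {ξ | ↑(pinnedEdges jM H jP P) ⊆ ξ} with hO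
  set AM : Set (Percolation.BondConfig M) := {ω | pinnedTransfer jM H jP P ω ∈ AV} with hAM
  have hOu : IsUpperSet O := fun ξ ξ' hle hξ => Set.Subset.trans hξ hle
  -- (1) Σ g = q^cM Z_H
  have S1 : ∑ b, fkWeight F W p q b = q ^ cM * ZH := by
    have h := sum_mul_fkWeight_map jM H B p q (fun _ => (1 : ℝ))
    simp only [one_mul] at h
    rw [h, hZH, rcPartitionFunction]
  -- (2) Σ μ g = q^cM Z_H ν(AM)
  have S2 : ∑ b, μ b * fkWeight F W p q b = q ^ cM * (ZH * (rcMeasure H p q B).real AM) := by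
    rw [sum_mul_fkWeight_map jM H B p q μ, rcMeasure_real_eq_sum_div H hp' hq0 B,
      mul_div_cancel₀ _ hZH0.ne']
    refine congrArg (q ^ cM * ·) (Finset.sum_congr rfl fun ω hω => ?_)
    have hT : Sym2.map jP ⁻¹' (↑(ω.map jM.sym2Map ∩ (E ∩ F) ∪ E \ F) : Set (Sym2 U)) =
        pinnedTransfer jM H jP P (↑ω : Percolation.BondConfig M) := by
      rw [pinnedTransfer, Finset.coe_union, Finset.coe_inter, Finset.coe_map]
      rfl
    have hμω : μ (ω.map jM.sym2Map) = if (↑ω : Percolation.BondConfig M) ∈ AM then 1 else 0 := by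
      simp only [hμ]
      rw [hT]
      rfl
    rw [hμω]
    split_ifs
    · rw [one_mul]
    · rw [zero_mul]
  -- (3) Σ f = q^cP Z_P φ(O)
  have hind : ∀ (G : Finset (Sym2 U) → ℝ),
      ∑ ξ ∈ E.powerset.filter (fun ξ => E \ F ⊆ ξ), G ξ * fkWeight E ∅ p q ξ =
        ∑ a, (if E \ F ⊆ a then G a else 0) * fkWeight E ∅ p q a := by
    intro G
    rw [Finset.sum_filter, ← Finset.sum_subset (Finset.subset_univ E.powerset)]
    · refine Finset.sum_congr rfl fun a _ => ?_
      split_ifs <;> simp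
    · intro a _ ha
      rw [Finset.mem_powerset] at ha
      rw [fkWeight, if_neg ha, mul_zero]
  have hEF : E \ F = (pinnedEdges jM H jP P).map jP.sym2Map := map_pinnedEdges.symm
  have hsubiff : ∀ ξ : Finset (Sym2 V), E \ F ⊆ ξ.map jP.sym2Map ↔
      (↑ξ : Percolation.BondConfig V) ∈ O := by
    intro ξ
    rw [hEF, Finset.map_subset_map, hO, Set.mem_setOf_eq, Finset.coe_subset]
  have hmapP : ∀ (G : Finset (Sym2 U) → ℝ), ∑ a, G a * fkWeight E ∅ p q a =
      q ^ cP * ∑ ξ ∈ P.edgeFinset.powerset, G (ξ.map jP.sym2Map) * rcWeight P p q ∅ ξ := by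
    intro G
    have h := sum_mul_fkWeight_map jP P ∅ p q G
    rwa [Set.image_empty] at h
  have S3 : ∑ a, pinnedWeight E F p q a = q ^ cP * (ZP * (rcMeasure P p q ∅).real O) := by
    have h := sum_mul_pinnedWeight E F p q (fun _ => (1 : ℝ))
    simp only [one_mul] at h
    rw [h]
    have h2 := hind (fun _ => 1)
    simp only [one_mul] at h2
    rw [h2, hmapP, rcMeasure_real_eq_sum_div P hp' hq0 ∅, mul_div_cancel₀ _ hZP0.ne']
    refine congrArg (q ^ cP * ·) (Finset.sum_congr rfl fun ξ _ => ?_)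
    by_cases h : (↑ξ : Percolation.BondConfig V) ∈ O
    · rw [if_pos ((hsubiff ξ).2 h), if_pos h, one_mul]
    · rw [if_neg (fun h' => h ((hsubiff ξ).1 h')), if_neg h, zero_mul]
  -- (4) Σ μ f = q^cP Z_P φ(AV ∩ O)
  have S4 : ∑ a, μ a * pinnedWeight E F p q a =
      q ^ cP * (ZP * (rcMeasure P p q ∅).real (AV ∩ O)) := by
    rw [sum_mul_pinnedWeight E F p q μ]
    have hμξ : ∀ ξ ∈ E.powerset.filter (fun ξ => E \ F ⊆ ξ),
        μ (ξ ∩ F) * fkWeight E ∅ p q ξ =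
          (if Sym2.map jP ⁻¹' (↑ξ : Set (Sym2 U)) ∈ AV then 1 else 0) * fkWeight E ∅ p q ξ := by
      intro ξ hξ
      rw [Finset.mem_filter, Finset.mem_powerset] at hξ
      have hset : ξ ∩ F ∩ (E ∩ F) ∪ E \ F = ξ := by
        ext e
        simp only [Finset.mem_union, Finset.mem_inter, Finset.mem_sdiff]
        constructor
        · rintro (h | h)
          · exact h.1.1
          · exact hξ.2 (Finset.mem_sdiff.2 h)
        · intro h
          by_cases heF : e ∈ F
          · exact Or.inl ⟨⟨h, heF⟩, hξ.1 h, heF⟩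
          · exact Or.inr ⟨hξ.1 h, heF⟩
      simp only [hμ]
      rw [hset]
    rw [Finset.sum_congr rfl hμξ, hind, hmapP, rcMeasure_real_eq_sum_div P hp' hq0 ∅,
      mul_div_cancel₀ _ hZP0.ne']
    refine congrArg (q ^ cP * ·) (Finset.sum_congr rfl fun ξ _ => ?_)
    rw [preimage_coe_map_sym2Map]
    by_cases h : (↑ξ : Percolation.BondConfig V) ∈ AV ∩ O
    · rw [if_pos ((hsubiff ξ).2 h.2), if_pos h.1, if_pos h, one_mul]
    · rw [if_neg h]
      by_cases h' : (↑ξ : Percolation.BondConfig V) ∈ O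
      · rw [if_pos ((hsubiff ξ).2 h'), if_neg (fun h'' => h ⟨h'', h'⟩), zero_mul]
      · rw [if_neg (fun h'' => h' ((hsubiff ξ).1 h'')), zero_mul]
  -- Holley: φ(AV ∩ O) ≤ ν(AM) φ(O)
  rw [S1, S2, S3, S4] at key
  have hqM : 0 < q ^ cM := pow_pos hq0 _
  have hqP : 0 < q ^ cP := pow_pos hq0 _
  have holley' : (rcMeasure P p q ∅).real (AV ∩ O) ≤
      (rcMeasure H p q B).real AM * (rcMeasure P p q ∅).real O := by
    have hc : 0 < q ^ cP * ZP * (q ^ cM * ZH) := by positivity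
    refine le_of_mul_le_mul_left ?_ hc
    calc q ^ cP * ZP * (q ^ cM * ZH) * (rcMeasure P p q ∅).real (AV ∩ O)
        = q ^ cP * (ZP * (rcMeasure P p q ∅).real (AV ∩ O)) * (q ^ cM * ZH) := by ring
      _ ≤ q ^ cM * (ZH * (rcMeasure H p q B).real AM) * (q ^ cP * (ZP * (rcMeasure P p q ∅).real O)) := key
      _ = _ := by ring
  -- complements and FKG
  haveI := isProbabilityMeasure_rcMeasure H hp' hq0 B
  have c1 := rcMeasure_real_inter_add_inter_compl P hp' hq0 ∅ O DV
  have c2 := rcMeasure_real_inter_add_inter_compl H hp' hq0 B Set.univ AM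
  rw [Set.univ_inter, Set.univ_inter, MeasureTheory.probReal_univ] at c2
  have hAMc : AMᶜ = {ω | pinnedTransfer jM H jP P ω ∈ DV} := by
    ext ω
    simp only [hAM, hAV, Set.mem_compl_iff, Set.mem_setOf_eq, not_not]
  rw [hAMc] at c2
  have hOc : O ∩ DVᶜ = AV ∩ O := by rw [hAV, Set.inter_comm]
  rw [hOc] at c1
  have fkg := rcMeasure_real_inter_le_of_isLowerSet P hp' hq ∅ hOu hDV
  -- positivity of φ(O): the all-open configuration
  have hOpos : 0 < (rcMeasure P p q ∅).real O := by
    rw [rcMeasure_real_eq_sum_div P hp' hq0 ∅]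
    refine div_pos ?_ hZP0
    have hmem : P.edgeFinset ∈ P.edgeFinset.powerset := Finset.mem_powerset.2 subset_rfl
    refine lt_of_lt_of_le ?_ (Finset.single_le_sum (fun ω _ => ?_) hmem)
    · have hin : (↑P.edgeFinset : Percolation.BondConfig V) ∈ O := by
        change ↑(pinnedEdges jM H jP P) ⊆ (↑P.edgeFinset : Set (Sym2 V))
        exact Finset.coe_subset.2 (Finset.filter_subset _ _)
      rw [if_pos hin, rcWeight, Finset.sdiff_self, Finset.card_empty, pow_zero, mul_one]
      exact mul_pos (pow_pos hp.1 _) (pow_pos hq0 _)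
    · split_ifs
      · exact rcWeight_nonneg P hp' hq0.le ∅ ω
      · exact le_rfl
  -- conclude
  refine le_of_mul_le_mul_left ?_ hOpos
  nlinarith [holley', c1, c2, fkg, hOpos,
    MeasureTheory.measureReal_nonneg (μ := rcMeasure P p q ∅) (s := AV ∩ O)]

end Embedded

end Literature.Probability.LatticeModels
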